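import Summits.BirchSwinnertonDyer.BirchSwinnertonDyer.Theorems.ByReductionTypeAtTwoSupersingularConjATwoGoodSSGenusDoor
import Summits.BirchSwinnertonDyer.BirchSwinnertonDyer.Theorems.ByReductionTypeAtTwoSupersingularConjATwoGoodSSRowKernelStamps
import Summits.BirchSwinnertonDyer.BirchSwinnertonDyer.Theorems.ByReductionTypeAtTwoSupersingularConjATwoGoodSSRowFieldCertificatesC
import HarnessLib

/-!
# Route `ByReductionTypeAtTwo` (rung K4), crux `SupersingularRankZeroAtTwo` (item stmt-BirchSwinnertonDyer-19097), registry v2.12 stub 3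
# `stub_fineMu : FineMuZeroOnHabitatAtTwo`: THE 13 COMPLEX-CUBIC ROWS (`Δ_E < 0`) OF THE h12 TRANCHE RE-KEYED THROUGH THE GENUS DOOR —
# (A)₂ / `FineMuZeroAt (M ⊗ ℚ) 2` UNCONDITIONAL (no `hLim2`, no displayed bit), part A (rows 11a1 … 135b1)
# (a `--supports 19097` file; seat `bsd-2adic-t42` GEN 44, sequel of task T-85 «THE NARROW DOOR RE-KEY» (director-bsd (825)(ii));
# re-keys GEN 43's `…GoodSSRowStampsA/B/C`, `…KernelStamps`, `…FieldCertificatesC` through `…GoodSSGenusDoor`)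

HONEST LABEL (cell `bsd-2adic`, D-0036/D-0054): THEOREMS ONLY (no definition, no named fact, no `sorry`). Every `conjA_two_<label>'` /
`fineMuZeroAt_two_<label>'` below is PROVED OUTRIGHT — Coates–Sujatha's statement (A) at `p = 2` for that ONE curve with no hypothesis
and no named fact (GEN 43's `conjA_two_<label> hLim2` needed Lim 2017 Thm. 3.5 at `2`; in scope there, `r₁ = 1`, but a named fact all
the same). Statement (A) is NOT BSD; stub 3 (class-wide) is NOT discharged by finitely many rows; 19097 OPEN; nothing booked; BSD is
proved for no curve.

MECHANISM (all kernel). Per row: GEN 43's generator swap `θ = u(β)`, `β = v(θ)` (verbatim) onto the `polredabs` cubic `g` of the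
`2`-torsion point field `L_W = ℚ(β) = ℚ(θ)`, a COMPLEX cubic field (`disc g < 0`, `norm_num`), `h(L_W)` odd BY THE KERNEL (GEN 43's
certificates, by name), ONE prime above `2` (`π = β/2` Eisenstein; `…GoodSSGenusDoor` §1); the genus door
`conjA_two_goodSSModel_of_generator_of_discr_neg` (k4-w1/k4-w2: one real place from `disc < 0`; Chevalley's ambiguous class number
formula on `ℚ(θ, √−1)/ℚ(θ)`, p722124; one prime above `2` in the sextic, p722472; Iwasawa 1956; cruxlead-19573-w2's unipotent-dévissage
door p718233) gives (A)₂ — NO Lim 2017 fact, NO Ferrero–Washington.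

References: [CoatesSujatha2005] Conj. A, Thm. 3.4; [Greenberg2001IwasawaPastPresent] Prop. 2.1; [Lang1990] Ch. 13 §4 Lemma 4.1;
[Cohen1993] Prop. 4.8.11; Cremona `ecdata` (minimal models); tree p718233, p722124, p722472, p723127, GEN 43 ★ p822499/p822896/p822901/
p822902/p823030/p823205.
-/

set_option autoImplicit false
-- sibling precedent (`…GoodSSGenusDoor.lean`): the directory name repeats the summit name
set_option linter.dupNamespace false

noncomputable section

open scoped Classical IntermediateField NumberField

namespace Summit.BirchSwinnertonDyer.BirchSwinnertonDyer.Theorems.AddKatoTwo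

open WeierstrassCurve Field Polynomial IsDedekindDomain NumberField Literature.NumberTheory.EllipticCurves
  Literature.NumberTheory.GaloisRepresentations Literature.NumberTheory.IwasawaTheory
  Summit.BirchSwinnertonDyer.BirchSwinnertonDyer.Theorems.AlignedTransportAtTwoTorsionPointField
  Summit.BirchSwinnertonDyer.BirchSwinnertonDyer.Theses.ByReductionTypeAtTwo

/-- **UNCONDITIONAL (A)₂ for `11a1` — ZERO hypotheses, ZERO named facts** (Cremona minimal model `[0, -1, 1, -10, -20]`; `2`-torsion cubic
field: `g = X³ + (-1)X² + (1)X + (1)`, `disc g = -44 < 0`, `h` odd by `not_two_dvd_card_classGroup_twoDivField_d44n`, one prime above `2`): for every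
cyclotomic `ℤ₂`-extension of `ℚ` some fine Selmer dual datum is finitely generated over `ℤ₂`. Genus door, NO Lim fact; UPGRADES
`conjA_two_11a1 hLim2` (GEN 43). BSD for `11a1` is NOT proved by this. [cite: CoatesSujatha2005, Conj. A and Thm. 3.4]
[cite: Greenberg2001IwasawaPastPresent, Prop. 2.1 p. 339] [cite: Cohen1993, Prop. 4.8.11] -/
theorem conjA_two_11a1' (κ : ZpExtension ℚ 2) (hκ : κ.IsCyclotomic) :
    haveI := isElliptic_goodSSModel (-1) (-10) (-20) (by simp only [Cubic.discr]; norm_num)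
    ∃ (γ : absoluteGaloisGroup ℚ) (D : ((⟨0, -1, 1, -10, -20⟩ : WeierstrassCurve ℤ).baseChange ℚ).FineSelmerDualData κ γ),
      Module.Finite ℤ_[2] (RestrictScalars ℤ_[2] (IwasawaAlgebra 2) D.X) := by
  haveI := isElliptic_goodSSModel (-1) (-10) (-20) (by simp only [Cubic.discr]; norm_num)
  refine conjA_two_goodSSModel_of_generator_of_discr_neg (-1) (-10) (-20) (-1) (1) (1) (-23/121) (-31/242) (3/484) (8) (-14) (6)
    (fun β θ hβ hθ ↦ ?_) (by norm_num [Cubic.discr]) (fun θ hθ ↦ not_two_dvd_card_classGroup_twoDivField_d44n hθ) κ hκ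
  subst hθ; push_cast at hβ ⊢
  exact ⟨by linear_combination (((-8599 : AlgebraicClosure ℚ) / 14172488) + ((6453 : AlgebraicClosure ℚ) / 28344976) * β + ((-783 : AlgebraicClosure ℚ) / 56689952) * β ^ 2 + ((27 : AlgebraicClosure ℚ) / 113379904) * β ^ 3) * hβ,
    by linear_combination (-1 : AlgebraicClosure ℚ) * (((-126 : AlgebraicClosure ℚ) / 14641) + ((27 : AlgebraicClosure ℚ) / 117128) * β) * hβ⟩

/-- **`FineMuZeroAt (11a1 ⊗ ℚ) 2` UNCONDITIONALLY** (stub-3 currency; upgrades `fineMuZeroAt_two_11a1 hLim2`).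
[cite: CoatesSujatha2005, Conj. A and Thm. 3.4] -/
theorem fineMuZeroAt_two_11a1' :
    haveI := isElliptic_goodSSModel (-1) (-10) (-20) (by simp only [Cubic.discr]; norm_num)
    Literature.NumberTheory.EllipticCurves.Rank1Residual.FineMuZeroAt ((⟨0, -1, 1, -10, -20⟩ : WeierstrassCurve ℤ).baseChange ℚ) 2 :=
  haveI := isElliptic_goodSSModel (-1) (-10) (-20) (by simp only [Cubic.discr]; norm_num)
  Literature.NumberTheory.EllipticCurves.Rank1Residual.ConjAAt.fineMuZeroAt conjA_two_11a1'

/-- **UNCONDITIONAL (A)₂ for `19a1` — ZERO hypotheses, ZERO named facts** (Cremona minimal model `[0, 1, 1, -9, -15]`; `2`-torsion cubic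
field: `g = X³ + (0)X² + (-2)X + (-2)`, `disc g = -76 < 0`, `h` odd by `not_two_dvd_card_classGroup_twoDivField_d76n`, one prime above `2`): for every
cyclotomic `ℤ₂`-extension of `ℚ` some fine Selmer dual datum is finitely generated over `ℤ₂`. Genus door, NO Lim fact; UPGRADES
`conjA_two_19a1 hLim2` (GEN 43). BSD for `19a1` is NOT proved by this. [cite: CoatesSujatha2005, Conj. A and Thm. 3.4]
[cite: Greenberg2001IwasawaPastPresent, Prop. 2.1 p. 339] [cite: Cohen1993, Prop. 4.8.11] -/
theorem conjA_two_19a1' (κ : ZpExtension ℚ 2) (hκ : κ.IsCyclotomic) :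
    haveI := SSUnitAnchor.isElliptic_ua19a1
    ∃ (γ : absoluteGaloisGroup ℚ) (D : ((⟨0, 1, 1, -9, -15⟩ : WeierstrassCurve ℤ).baseChange ℚ).FineSelmerDualData κ γ),
      Module.Finite ℤ_[2] (RestrictScalars ℤ_[2] (IwasawaAlgebra 2) D.X) := by
  haveI := SSUnitAnchor.isElliptic_ua19a1
  refine conjA_two_goodSSModel_of_generator_of_discr_neg (1) (-9) (-15) (0) (-2) (-2) (30/19) (7/38) (-1/76) (-4) (6) (2)
    (fun β θ hβ hθ ↦ ?_) (by norm_num [Cubic.discr]) (fun θ hθ ↦ not_two_dvd_card_classGroup_twoDivField_d76n hθ) κ hκ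
  subst hθ; push_cast at hβ ⊢
  exact ⟨by linear_combination (((71 : AlgebraicClosure ℚ) / 54872) + ((-139 : AlgebraicClosure ℚ) / 109744) * β + ((23 : AlgebraicClosure ℚ) / 219488) * β ^ 2 + ((-1 : AlgebraicClosure ℚ) / 438976) * β ^ 3) * hβ,
    by linear_combination (-1 : AlgebraicClosure ℚ) * (((-4 : AlgebraicClosure ℚ) / 361) + ((1 : AlgebraicClosure ℚ) / 2888) * β) * hβ⟩

/-- **`FineMuZeroAt (19a1 ⊗ ℚ) 2` UNCONDITIONALLY** (stub-3 currency; upgrades `fineMuZeroAt_two_19a1 hLim2`).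
[cite: CoatesSujatha2005, Conj. A and Thm. 3.4] -/
theorem fineMuZeroAt_two_19a1' :
    haveI := SSUnitAnchor.isElliptic_ua19a1
    Literature.NumberTheory.EllipticCurves.Rank1Residual.FineMuZeroAt ((⟨0, 1, 1, -9, -15⟩ : WeierstrassCurve ℤ).baseChange ℚ) 2 :=
  haveI := SSUnitAnchor.isElliptic_ua19a1
  Literature.NumberTheory.EllipticCurves.Rank1Residual.ConjAAt.fineMuZeroAt conjA_two_19a1'

/-- **UNCONDITIONAL (A)₂ for `35a1` — ZERO hypotheses, ZERO named facts** (Cremona minimal model `[0, 1, 1, 9, 1]`; `2`-torsion cubic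
field: `g = X³ + (0)X² + (2)X + (-2)`, `disc g = -140 < 0`, `h` odd by `not_two_dvd_card_classGroup_twoDivField_d140n`, one prime above `2`): for every
cyclotomic `ℤ₂`-extension of `ℚ` some fine Selmer dual datum is finitely generated over `ℤ₂`. Genus door, NO Lim fact; UPGRADES
`conjA_two_35a1 hLim2` (GEN 43). BSD for `35a1` is NOT proved by this. [cite: CoatesSujatha2005, Conj. A and Thm. 3.4]
[cite: Greenberg2001IwasawaPastPresent, Prop. 2.1 p. 339] [cite: Cohen1993, Prop. 4.8.11] -/
theorem conjA_two_35a1' (κ : ZpExtension ℚ 2) (hκ : κ.IsCyclotomic) :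
    haveI := SSUnitAnchor.isElliptic_ua35a1
    ∃ (γ : absoluteGaloisGroup ℚ) (D : ((⟨0, 1, 1, 9, 1⟩ : WeierstrassCurve ℤ).baseChange ℚ).FineSelmerDualData κ γ),
      Module.Finite ℤ_[2] (RestrictScalars ℤ_[2] (IwasawaAlgebra 2) D.X) := by
  haveI := SSUnitAnchor.isElliptic_ua35a1
  refine conjA_two_goodSSModel_of_generator_of_discr_neg (1) (9) (1) (0) (2) (-2) (6/7) (11/70) (1/140) (-4) (6) (-2)
    (fun β θ hβ hθ ↦ ?_) (by norm_num [Cubic.discr]) (fun θ hθ ↦ not_two_dvd_card_classGroup_twoDivField_d140n hθ) κ hκ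
  subst hθ; push_cast at hβ ⊢
  exact ⟨by linear_combination (((59 : AlgebraicClosure ℚ) / 13720) + ((71 : AlgebraicClosure ℚ) / 137200) * β + ((31 : AlgebraicClosure ℚ) / 1372000) * β ^ 2 + ((1 : AlgebraicClosure ℚ) / 2744000) * β ^ 3) * hβ,
    by linear_combination (-1 : AlgebraicClosure ℚ) * (((-1 : AlgebraicClosure ℚ) / 245) + ((-1 : AlgebraicClosure ℚ) / 9800) * β) * hβ⟩

/-- **`FineMuZeroAt (35a1 ⊗ ℚ) 2` UNCONDITIONALLY** (stub-3 currency; upgrades `fineMuZeroAt_two_35a1 hLim2`).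
[cite: CoatesSujatha2005, Conj. A and Thm. 3.4] -/
theorem fineMuZeroAt_two_35a1' :
    haveI := SSUnitAnchor.isElliptic_ua35a1
    Literature.NumberTheory.EllipticCurves.Rank1Residual.FineMuZeroAt ((⟨0, 1, 1, 9, 1⟩ : WeierstrassCurve ℤ).baseChange ℚ) 2 :=
  haveI := SSUnitAnchor.isElliptic_ua35a1
  Literature.NumberTheory.EllipticCurves.Rank1Residual.ConjAAt.fineMuZeroAt conjA_two_35a1'

/-- **UNCONDITIONAL (A)₂ for `51a1` — ZERO hypotheses, ZERO named facts** (Cremona minimal model `[0, 1, 1, 1, -1]`; `2`-torsion cubic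
field: `g = X³ + (-1)X² + (1)X + (-3)`, `disc g = -204 < 0`, `h` odd by `not_two_dvd_card_classGroup_twoDivField_d204n`, one prime above `2`): for every
cyclotomic `ℤ₂`-extension of `ℚ` some fine Selmer dual datum is finitely generated over `ℤ₂`. Genus door, NO Lim fact; UPGRADES
`conjA_two_51a1 hLim2` (GEN 43). BSD for `51a1` is NOT proved by this. [cite: CoatesSujatha2005, Conj. A and Thm. 3.4]
[cite: Greenberg2001IwasawaPastPresent, Prop. 2.1 p. 339] [cite: Cohen1993, Prop. 4.8.11] -/
theorem conjA_two_51a1' (κ : ZpExtension ℚ 2) (hκ : κ.IsCyclotomic) :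
    haveI := SSUnitAnchor.isElliptic_ua51a1
    ∃ (γ : absoluteGaloisGroup ℚ) (D : ((⟨0, 1, 1, 1, -1⟩ : WeierstrassCurve ℤ).baseChange ℚ).FineSelmerDualData κ γ),
      Module.Finite ℤ_[2] (RestrictScalars ℤ_[2] (IwasawaAlgebra 2) D.X) := by
  haveI := SSUnitAnchor.isElliptic_ua51a1
  refine conjA_two_goodSSModel_of_generator_of_discr_neg (1) (1) (-1) (-1) (1) (-3) (1) (1/6) (1/12) (0) (-2) (2)
    (fun β θ hβ hθ ↦ ?_) (by norm_num [Cubic.discr]) (fun θ hθ ↦ not_two_dvd_card_classGroup_twoDivField_d204n hθ) κ hκ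
  subst hθ; push_cast at hβ ⊢
  exact ⟨by linear_combination (((1 : AlgebraicClosure ℚ) / 24) + ((1 : AlgebraicClosure ℚ) / 144) * β + ((1 : AlgebraicClosure ℚ) / 864) * β ^ 2 + ((1 : AlgebraicClosure ℚ) / 1728) * β ^ 3) * hβ,
    by linear_combination (-1 : AlgebraicClosure ℚ) * (((1 : AlgebraicClosure ℚ) / 72) * β) * hβ⟩

/-- **`FineMuZeroAt (51a1 ⊗ ℚ) 2` UNCONDITIONALLY** (stub-3 currency; upgrades `fineMuZeroAt_two_51a1 hLim2`).
[cite: CoatesSujatha2005, Conj. A and Thm. 3.4] -/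
theorem fineMuZeroAt_two_51a1' :
    haveI := SSUnitAnchor.isElliptic_ua51a1
    Literature.NumberTheory.EllipticCurves.Rank1Residual.FineMuZeroAt ((⟨0, 1, 1, 1, -1⟩ : WeierstrassCurve ℤ).baseChange ℚ) 2 :=
  haveI := SSUnitAnchor.isElliptic_ua51a1
  Literature.NumberTheory.EllipticCurves.Rank1Residual.ConjAAt.fineMuZeroAt conjA_two_51a1'

/-- **UNCONDITIONAL (A)₂ for `57c1` — ZERO hypotheses, ZERO named facts** (Cremona minimal model `[0, 1, 1, 20, -32]`; `2`-torsion cubic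
field: `g = X³ + (0)X² + (-2)X + (-2)`, `disc g = -76 < 0`, `h` odd by `not_two_dvd_card_classGroup_twoDivField_d76n`, one prime above `2`): for every
cyclotomic `ℤ₂`-extension of `ℚ` some fine Selmer dual datum is finitely generated over `ℤ₂`. Genus door, NO Lim fact; UPGRADES
`conjA_two_57c1 hLim2` (GEN 43). BSD for `57c1` is NOT proved by this. [cite: CoatesSujatha2005, Conj. A and Thm. 3.4]
[cite: Greenberg2001IwasawaPastPresent, Prop. 2.1 p. 339] [cite: Cohen1993, Prop. 4.8.11] -/
theorem conjA_two_57c1' (κ : ZpExtension ℚ 2) (hκ : κ.IsCyclotomic) :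
    haveI := isElliptic_57c1
    ∃ (γ : absoluteGaloisGroup ℚ) (D : ((⟨0, 1, 1, 20, -32⟩ : WeierstrassCurve ℤ).baseChange ℚ).FineSelmerDualData κ γ),
      Module.Finite ℤ_[2] (RestrictScalars ℤ_[2] (IwasawaAlgebra 2) D.X) := by
  haveI := isElliptic_57c1
  refine conjA_two_goodSSModel_of_generator_of_discr_neg (1) (20) (-32) (0) (-2) (-2) (286/243) (13/162) (5/972) (12) (14) (-10)
    (fun β θ hβ hθ ↦ ?_) (by norm_num [Cubic.discr]) (fun θ hθ ↦ not_two_dvd_card_classGroup_twoDivField_d76n hθ) κ hκ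
  subst hθ; push_cast at hβ ⊢
  exact ⟨by linear_combination (((153859 : AlgebraicClosure ℚ) / 114791256) + ((28915 : AlgebraicClosure ℚ) / 229582512) * β + ((2675 : AlgebraicClosure ℚ) / 459165024) * β ^ 2 + ((125 : AlgebraicClosure ℚ) / 918330048) * β ^ 3) * hβ,
    by linear_combination (-1 : AlgebraicClosure ℚ) * (((-425 : AlgebraicClosure ℚ) / 59049) + ((-125 : AlgebraicClosure ℚ) / 472392) * β) * hβ⟩

/-- **`FineMuZeroAt (57c1 ⊗ ℚ) 2` UNCONDITIONALLY** (stub-3 currency; upgrades `fineMuZeroAt_two_57c1 hLim2`).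
[cite: CoatesSujatha2005, Conj. A and Thm. 3.4] -/
theorem fineMuZeroAt_two_57c1' :
    haveI := isElliptic_57c1
    Literature.NumberTheory.EllipticCurves.Rank1Residual.FineMuZeroAt ((⟨0, 1, 1, 20, -32⟩ : WeierstrassCurve ℤ).baseChange ℚ) 2 :=
  haveI := isElliptic_57c1
  Literature.NumberTheory.EllipticCurves.Rank1Residual.ConjAAt.fineMuZeroAt conjA_two_57c1'

/-- **UNCONDITIONAL (A)₂ for `67a1` — ZERO hypotheses, ZERO named facts** (Cremona minimal model `[0, 1, 1, -12, -21]`; `2`-torsion cubic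
field: `g = X³ + (-1)X² + (-3)X + (5)`, `disc g = -268 < 0`, `h` odd by `not_two_dvd_card_classGroup_twoDivField_d268n`, one prime above `2`): for every
cyclotomic `ℤ₂`-extension of `ℚ` some fine Selmer dual datum is finitely generated over `ℤ₂`. Genus door, NO Lim fact; UPGRADES
`conjA_two_67a1 hLim2` (GEN 43). BSD for `67a1` is NOT proved by this. [cite: CoatesSujatha2005, Conj. A and Thm. 3.4]
[cite: Greenberg2001IwasawaPastPresent, Prop. 2.1 p. 339] [cite: Cohen1993, Prop. 4.8.11] -/
theorem conjA_two_67a1' (κ : ZpExtension ℚ 2) (hκ : κ.IsCyclotomic) :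
    haveI := SSUnitAnchor.isElliptic_ua67a1
    ∃ (γ : absoluteGaloisGroup ℚ) (D : ((⟨0, 1, 1, -12, -21⟩ : WeierstrassCurve ℤ).baseChange ℚ).FineSelmerDualData κ γ),
      Module.Finite ℤ_[2] (RestrictScalars ℤ_[2] (IwasawaAlgebra 2) D.X) := by
  haveI := SSUnitAnchor.isElliptic_ua67a1
  refine conjA_two_goodSSModel_of_generator_of_discr_neg (1) (-12) (-21) (-1) (-3) (5) (-35) (-3/2) (1/4) (-4) (-6) (2)
    (fun β θ hβ hθ ↦ ?_) (by norm_num [Cubic.discr]) (fun θ hθ ↦ not_two_dvd_card_classGroup_twoDivField_d268n hθ) κ hκ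
  subst hθ; push_cast at hβ ⊢
  exact ⟨by linear_combination (((265 : AlgebraicClosure ℚ) / 8) + ((-9 : AlgebraicClosure ℚ) / 16) * β + ((-11 : AlgebraicClosure ℚ) / 32) * β ^ 2 + ((1 : AlgebraicClosure ℚ) / 64) * β ^ 3) * hβ,
    by linear_combination (-1 : AlgebraicClosure ℚ) * ((-2 : AlgebraicClosure ℚ) + ((1 : AlgebraicClosure ℚ) / 8) * β) * hβ⟩

/-- **`FineMuZeroAt (67a1 ⊗ ℚ) 2` UNCONDITIONALLY** (stub-3 currency; upgrades `fineMuZeroAt_two_67a1 hLim2`).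
[cite: CoatesSujatha2005, Conj. A and Thm. 3.4] -/
theorem fineMuZeroAt_two_67a1' :
    haveI := SSUnitAnchor.isElliptic_ua67a1
    Literature.NumberTheory.EllipticCurves.Rank1Residual.FineMuZeroAt ((⟨0, 1, 1, -12, -21⟩ : WeierstrassCurve ℤ).baseChange ℚ) 2 :=
  haveI := SSUnitAnchor.isElliptic_ua67a1
  Literature.NumberTheory.EllipticCurves.Rank1Residual.ConjAAt.fineMuZeroAt conjA_two_67a1'

/-- **UNCONDITIONAL (A)₂ for `75a1` — ZERO hypotheses, ZERO named facts** (Cremona minimal model `[0, -1, 1, -8, -7]`; `2`-torsion cubic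
field: `g = X³ + (-1)X² + (-3)X + (-3)`, `disc g = -300 < 0`, `h` odd by `not_two_dvd_card_classGroup_twoDivField_d300n`, one prime above `2`): for every
cyclotomic `ℤ₂`-extension of `ℚ` some fine Selmer dual datum is finitely generated over `ℤ₂`. Genus door, NO Lim fact; UPGRADES
`conjA_two_75a1 hLim2` (GEN 43). BSD for `75a1` is NOT proved by this. [cite: CoatesSujatha2005, Conj. A and Thm. 3.4]
[cite: Greenberg2001IwasawaPastPresent, Prop. 2.1 p. 339] [cite: Cohen1993, Prop. 4.8.11] -/
theorem conjA_two_75a1' (κ : ZpExtension ℚ 2) (hκ : κ.IsCyclotomic) :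
    haveI := SSUnitAnchor.isElliptic_ua75a1
    ∃ (γ : absoluteGaloisGroup ℚ) (D : ((⟨0, -1, 1, -8, -7⟩ : WeierstrassCurve ℤ).baseChange ℚ).FineSelmerDualData κ γ),
      Module.Finite ℤ_[2] (RestrictScalars ℤ_[2] (IwasawaAlgebra 2) D.X) := by
  haveI := SSUnitAnchor.isElliptic_ua75a1
  refine conjA_two_goodSSModel_of_generator_of_discr_neg (-1) (-8) (-7) (-1) (-3) (-3) (-19/5) (-3/10) (1/20) (-4) (2) (2)
    (fun β θ hβ hθ ↦ ?_) (by norm_num [Cubic.discr]) (fun θ hθ ↦ not_two_dvd_card_classGroup_twoDivField_d300n hθ) κ hκ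
  subst hθ; push_cast at hβ ⊢
  exact ⟨by linear_combination (((141 : AlgebraicClosure ℚ) / 1000) + ((-17 : AlgebraicClosure ℚ) / 2000) * β + ((-7 : AlgebraicClosure ℚ) / 4000) * β ^ 2 + ((1 : AlgebraicClosure ℚ) / 8000) * β ^ 3) * hβ,
    by linear_combination (-1 : AlgebraicClosure ℚ) * (((-1 : AlgebraicClosure ℚ) / 25) + ((1 : AlgebraicClosure ℚ) / 200) * β) * hβ⟩

/-- **`FineMuZeroAt (75a1 ⊗ ℚ) 2` UNCONDITIONALLY** (stub-3 currency; upgrades `fineMuZeroAt_two_75a1 hLim2`).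
[cite: CoatesSujatha2005, Conj. A and Thm. 3.4] -/
theorem fineMuZeroAt_two_75a1' :
    haveI := SSUnitAnchor.isElliptic_ua75a1
    Literature.NumberTheory.EllipticCurves.Rank1Residual.FineMuZeroAt ((⟨0, -1, 1, -8, -7⟩ : WeierstrassCurve ℤ).baseChange ℚ) 2 :=
  haveI := SSUnitAnchor.isElliptic_ua75a1
  Literature.NumberTheory.EllipticCurves.Rank1Residual.ConjAAt.fineMuZeroAt conjA_two_75a1'

/-- **UNCONDITIONAL (A)₂ for `75c1` — ZERO hypotheses, ZERO named facts** (Cremona minimal model `[0, 1, 1, 2, 4]`; `2`-torsion cubic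
field: `g = X³ + (-1)X² + (-3)X + (-3)`, `disc g = -300 < 0`, `h` odd by `not_two_dvd_card_classGroup_twoDivField_d300n`, one prime above `2`): for every
cyclotomic `ℤ₂`-extension of `ℚ` some fine Selmer dual datum is finitely generated over `ℤ₂`. Genus door, NO Lim fact; UPGRADES
`conjA_two_75c1 hLim2` (GEN 43). BSD for `75c1` is NOT proved by this. [cite: CoatesSujatha2005, Conj. A and Thm. 3.4]
[cite: Greenberg2001IwasawaPastPresent, Prop. 2.1 p. 339] [cite: Cohen1993, Prop. 4.8.11] -/
theorem conjA_two_75c1' (κ : ZpExtension ℚ 2) (hκ : κ.IsCyclotomic) :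
    haveI := isElliptic_75c1
    ∃ (γ : absoluteGaloisGroup ℚ) (D : ((⟨0, 1, 1, 2, 4⟩ : WeierstrassCurve ℤ).baseChange ℚ).FineSelmerDualData κ γ),
      Module.Finite ℤ_[2] (RestrictScalars ℤ_[2] (IwasawaAlgebra 2) D.X) := by
  haveI := isElliptic_75c1
  refine conjA_two_goodSSModel_of_generator_of_discr_neg (1) (2) (4) (-1) (-3) (-3) (5/9) (-1/6) (1/36) (-4) (-6) (2)
    (fun β θ hβ hθ ↦ ?_) (by norm_num [Cubic.discr]) (fun θ hθ ↦ not_two_dvd_card_classGroup_twoDivField_d300n hθ) κ hκ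
  subst hθ; push_cast at hβ ⊢
  exact ⟨by linear_combination (((-103 : AlgebraicClosure ℚ) / 5832) + ((47 : AlgebraicClosure ℚ) / 11664) * β + ((-11 : AlgebraicClosure ℚ) / 23328) * β ^ 2 + ((1 : AlgebraicClosure ℚ) / 46656) * β ^ 3) * hβ,
    by linear_combination (-1 : AlgebraicClosure ℚ) * (((-2 : AlgebraicClosure ℚ) / 81) + ((1 : AlgebraicClosure ℚ) / 648) * β) * hβ⟩

/-- **`FineMuZeroAt (75c1 ⊗ ℚ) 2` UNCONDITIONALLY** (stub-3 currency; upgrades `fineMuZeroAt_two_75c1 hLim2`).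
[cite: CoatesSujatha2005, Conj. A and Thm. 3.4] -/
theorem fineMuZeroAt_two_75c1' :
    haveI := isElliptic_75c1
    Literature.NumberTheory.EllipticCurves.Rank1Residual.FineMuZeroAt ((⟨0, 1, 1, 2, 4⟩ : WeierstrassCurve ℤ).baseChange ℚ) 2 :=
  haveI := isElliptic_75c1
  Literature.NumberTheory.EllipticCurves.Rank1Residual.ConjAAt.fineMuZeroAt conjA_two_75c1'

/-- **UNCONDITIONAL (A)₂ for `77b1` — ZERO hypotheses, ZERO named facts** (Cremona minimal model `[0, 1, 1, -49, 600]`; `2`-torsion cubic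
field: `g = X³ + (-1)X² + (1)X + (1)`, `disc g = -44 < 0`, `h` odd by `not_two_dvd_card_classGroup_twoDivField_d44n`, one prime above `2`): for every
cyclotomic `ℤ₂`-extension of `ℚ` some fine Selmer dual datum is finitely generated over `ℤ₂`. Genus door, NO Lim fact; UPGRADES
`conjA_two_77b1 hLim2` (GEN 43). BSD for `77b1` is NOT proved by this. [cite: CoatesSujatha2005, Conj. A and Thm. 3.4]
[cite: Greenberg2001IwasawaPastPresent, Prop. 2.1 p. 339] [cite: Cohen1993, Prop. 4.8.11] -/
theorem conjA_two_77b1' (κ : ZpExtension ℚ 2) (hκ : κ.IsCyclotomic) :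
    haveI := isElliptic_77b1
    ∃ (γ : absoluteGaloisGroup ℚ) (D : ((⟨0, 1, 1, -49, 600⟩ : WeierstrassCurve ℤ).baseChange ℚ).FineSelmerDualData κ γ),
      Module.Finite ℤ_[2] (RestrictScalars ℤ_[2] (IwasawaAlgebra 2) D.X) := by
  haveI := isElliptic_77b1
  refine conjA_two_goodSSModel_of_generator_of_discr_neg (1) (-49) (600) (-1) (1) (1) (65/77) (-79/7546) (-15/15092) (-20) (26) (-30)
    (fun β θ hβ hθ ↦ ?_) (by norm_num [Cubic.discr]) (fun θ hθ ↦ not_two_dvd_card_classGroup_twoDivField_d44n hθ) κ hκ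
  subst hθ; push_cast at hβ ⊢
  exact ⟨by linear_combination (((395609 : AlgebraicClosure ℚ) / 8769085864) + ((451755 : AlgebraicClosure ℚ) / 859370414672) * β + ((-46575 : AlgebraicClosure ℚ) / 1718740829344) * β ^ 2 + ((-3375 : AlgebraicClosure ℚ) / 3437481658688) * β ^ 3) * hβ,
    by linear_combination (-1 : AlgebraicClosure ℚ) * (((-7200 : AlgebraicClosure ℚ) / 14235529) + ((-3375 : AlgebraicClosure ℚ) / 113884232) * β) * hβ⟩

/-- **`FineMuZeroAt (77b1 ⊗ ℚ) 2` UNCONDITIONALLY** (stub-3 currency; upgrades `fineMuZeroAt_two_77b1 hLim2`).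
[cite: CoatesSujatha2005, Conj. A and Thm. 3.4] -/
theorem fineMuZeroAt_two_77b1' :
    haveI := isElliptic_77b1
    Literature.NumberTheory.EllipticCurves.Rank1Residual.FineMuZeroAt ((⟨0, 1, 1, -49, 600⟩ : WeierstrassCurve ℤ).baseChange ℚ) 2 :=
  haveI := isElliptic_77b1
  Literature.NumberTheory.EllipticCurves.Rank1Residual.ConjAAt.fineMuZeroAt conjA_two_77b1'

/-- **UNCONDITIONAL (A)₂ for `99d1` — ZERO hypotheses, ZERO named facts** (Cremona minimal model `[0, 0, 1, -3, -5]`; `2`-torsion cubic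
field: `g = X³ + (-1)X² + (1)X + (1)`, `disc g = -44 < 0`, `h` odd by `not_two_dvd_card_classGroup_twoDivField_d44n`, one prime above `2`): for every
cyclotomic `ℤ₂`-extension of `ℚ` some fine Selmer dual datum is finitely generated over `ℤ₂`. Genus door, NO Lim fact; UPGRADES
`conjA_two_99d1 hLim2` (GEN 43). BSD for `99d1` is NOT proved by this. [cite: CoatesSujatha2005, Conj. A and Thm. 3.4]
[cite: Greenberg2001IwasawaPastPresent, Prop. 2.1 p. 339] [cite: Cohen1993, Prop. 4.8.11] -/
theorem conjA_two_99d1' (κ : ZpExtension ℚ 2) (hκ : κ.IsCyclotomic) :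
    haveI := SSUnitAnchor.isElliptic_ua99d1
    ∃ (γ : absoluteGaloisGroup ℚ) (D : ((⟨0, 0, 1, -3, -5⟩ : WeierstrassCurve ℤ).baseChange ℚ).FineSelmerDualData κ γ),
      Module.Finite ℤ_[2] (RestrictScalars ℤ_[2] (IwasawaAlgebra 2) D.X) := by
  haveI := SSUnitAnchor.isElliptic_ua99d1
  refine conjA_two_goodSSModel_of_generator_of_discr_neg (0) (-3) (-5) (-1) (1) (1) (11/9) (1/18) (-1/36) (4) (-6) (6)
    (fun β θ hβ hθ ↦ ?_) (by norm_num [Cubic.discr]) (fun θ hθ ↦ not_two_dvd_card_classGroup_twoDivField_d44n hθ) κ hκ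
  subst hθ; push_cast at hβ ⊢
  exact ⟨by linear_combination (((-49 : AlgebraicClosure ℚ) / 5832) + ((1 : AlgebraicClosure ℚ) / 1296) * β + ((1 : AlgebraicClosure ℚ) / 7776) * β ^ 2 + ((-1 : AlgebraicClosure ℚ) / 46656) * β ^ 3) * hβ,
    by linear_combination (-1 : AlgebraicClosure ℚ) * (((-1 : AlgebraicClosure ℚ) / 54) + ((1 : AlgebraicClosure ℚ) / 216) * β) * hβ⟩

/-- **`FineMuZeroAt (99d1 ⊗ ℚ) 2` UNCONDITIONALLY** (stub-3 currency; upgrades `fineMuZeroAt_two_99d1 hLim2`).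
[cite: CoatesSujatha2005, Conj. A and Thm. 3.4] -/
theorem fineMuZeroAt_two_99d1' :
    haveI := SSUnitAnchor.isElliptic_ua99d1
    Literature.NumberTheory.EllipticCurves.Rank1Residual.FineMuZeroAt ((⟨0, 0, 1, -3, -5⟩ : WeierstrassCurve ℤ).baseChange ℚ) 2 :=
  haveI := SSUnitAnchor.isElliptic_ua99d1
  Literature.NumberTheory.EllipticCurves.Rank1Residual.ConjAAt.fineMuZeroAt conjA_two_99d1'

/-- **UNCONDITIONAL (A)₂ for `115a1` — ZERO hypotheses, ZERO named facts** (Cremona minimal model `[0, 0, 1, 7, -11]`; `2`-torsion cubic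
field: `g = X³ + (-1)X² + (5)X + (-3)`, `disc g = -460 < 0`, `h` odd by `not_two_dvd_card_classGroup_twoDivField_d460n`, one prime above `2`): for every
cyclotomic `ℤ₂`-extension of `ℚ` some fine Selmer dual datum is finitely generated over `ℤ₂`. Genus door, NO Lim fact; UPGRADES
`conjA_two_115a1 hLim2` (GEN 43). BSD for `115a1` is NOT proved by this. [cite: CoatesSujatha2005, Conj. A and Thm. 3.4]
[cite: Greenberg2001IwasawaPastPresent, Prop. 2.1 p. 339] [cite: Cohen1993, Prop. 4.8.11] -/
theorem conjA_two_115a1' (κ : ZpExtension ℚ 2) (hκ : κ.IsCyclotomic) :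
    haveI := SSUnitAnchor.isElliptic_ua115a1
    ∃ (γ : absoluteGaloisGroup ℚ) (D : ((⟨0, 0, 1, 7, -11⟩ : WeierstrassCurve ℤ).baseChange ℚ).FineSelmerDualData κ γ),
      Module.Finite ℤ_[2] (RestrictScalars ℤ_[2] (IwasawaAlgebra 2) D.X) := by
  haveI := SSUnitAnchor.isElliptic_ua115a1
  refine conjA_two_goodSSModel_of_generator_of_discr_neg (0) (7) (-11) (-1) (5) (-3) (27/25) (-7/50) (1/100) (8) (-6) (2)
    (fun β θ hβ hθ ↦ ?_) (by norm_num [Cubic.discr]) (fun θ hθ ↦ not_two_dvd_card_classGroup_twoDivField_d460n hθ) κ hκ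
  subst hθ; push_cast at hβ ⊢
  exact ⟨by linear_combination (((-453 : AlgebraicClosure ℚ) / 125000) + ((7 : AlgebraicClosure ℚ) / 10000) * β + ((-21 : AlgebraicClosure ℚ) / 500000) * β ^ 2 + ((1 : AlgebraicClosure ℚ) / 1000000) * β ^ 3) * hβ,
    by linear_combination (-1 : AlgebraicClosure ℚ) * (((-7 : AlgebraicClosure ℚ) / 1250) + ((1 : AlgebraicClosure ℚ) / 5000) * β) * hβ⟩

/-- **`FineMuZeroAt (115a1 ⊗ ℚ) 2` UNCONDITIONALLY** (stub-3 currency; upgrades `fineMuZeroAt_two_115a1 hLim2`).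
[cite: CoatesSujatha2005, Conj. A and Thm. 3.4] -/
theorem fineMuZeroAt_two_115a1' :
    haveI := SSUnitAnchor.isElliptic_ua115a1
    Literature.NumberTheory.EllipticCurves.Rank1Residual.FineMuZeroAt ((⟨0, 0, 1, 7, -11⟩ : WeierstrassCurve ℤ).baseChange ℚ) 2 :=
  haveI := SSUnitAnchor.isElliptic_ua115a1
  Literature.NumberTheory.EllipticCurves.Rank1Residual.ConjAAt.fineMuZeroAt conjA_two_115a1'

/-- **UNCONDITIONAL (A)₂ for `121d1` — ZERO hypotheses, ZERO named facts** (Cremona minimal model `[0, -1, 1, -40, -221]`; `2`-torsion cubic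
field: `g = X³ + (-1)X² + (1)X + (1)`, `disc g = -44 < 0`, `h` odd by `not_two_dvd_card_classGroup_twoDivField_d44n`, one prime above `2`): for every
cyclotomic `ℤ₂`-extension of `ℚ` some fine Selmer dual datum is finitely generated over `ℤ₂`. Genus door, NO Lim fact; UPGRADES
`conjA_two_121d1 hLim2` (GEN 43). BSD for `121d1` is NOT proved by this. [cite: CoatesSujatha2005, Conj. A and Thm. 3.4]
[cite: Greenberg2001IwasawaPastPresent, Prop. 2.1 p. 339] [cite: Cohen1993, Prop. 4.8.11] -/
theorem conjA_two_121d1' (κ : ZpExtension ℚ 2) (hκ : κ.IsCyclotomic) :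
    haveI := isElliptic_121d1
    ∃ (γ : absoluteGaloisGroup ℚ) (D : ((⟨0, -1, 1, -40, -221⟩ : WeierstrassCurve ℤ).baseChange ℚ).FineSelmerDualData κ γ),
      Module.Finite ℤ_[2] (RestrictScalars ℤ_[2] (IwasawaAlgebra 2) D.X) := by
  haveI := isElliptic_121d1
  refine conjA_two_goodSSModel_of_generator_of_discr_neg (-1) (-40) (-221) (-1) (1) (1) (145/121) (5/242) (-1/484) (16) (-22) (22)
    (fun β θ hβ hθ ↦ ?_) (by norm_num [Cubic.discr]) (fun θ hθ ↦ not_two_dvd_card_classGroup_twoDivField_d44n hθ) κ hκ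
  subst hθ; push_cast at hβ ⊢
  exact ⟨by linear_combination (((-2491 : AlgebraicClosure ℚ) / 14172488) + ((105 : AlgebraicClosure ℚ) / 28344976) * β + ((13 : AlgebraicClosure ℚ) / 56689952) * β ^ 2 + ((-1 : AlgebraicClosure ℚ) / 113379904) * β ^ 3) * hβ,
    by linear_combination (-1 : AlgebraicClosure ℚ) * (((-2 : AlgebraicClosure ℚ) / 1331) + ((1 : AlgebraicClosure ℚ) / 10648) * β) * hβ⟩

/-- **`FineMuZeroAt (121d1 ⊗ ℚ) 2` UNCONDITIONALLY** (stub-3 currency; upgrades `fineMuZeroAt_two_121d1 hLim2`).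
[cite: CoatesSujatha2005, Conj. A and Thm. 3.4] -/
theorem fineMuZeroAt_two_121d1' :
    haveI := isElliptic_121d1
    Literature.NumberTheory.EllipticCurves.Rank1Residual.FineMuZeroAt ((⟨0, -1, 1, -40, -221⟩ : WeierstrassCurve ℤ).baseChange ℚ) 2 :=
  haveI := isElliptic_121d1
  Literature.NumberTheory.EllipticCurves.Rank1Residual.ConjAAt.fineMuZeroAt conjA_two_121d1'

/-- **UNCONDITIONAL (A)₂ for `135b1` — ZERO hypotheses, ZERO named facts** (Cremona minimal model `[0, 0, 1, -27, -115]`; `2`-torsion cubic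
field: `g = X³ + (0)X² + (0)X + (-2)`, `disc g = -108 < 0`, `h` odd by `not_two_dvd_card_classGroup_twoDivField_d108n`, one prime above `2`): for every
cyclotomic `ℤ₂`-extension of `ℚ` some fine Selmer dual datum is finitely generated over `ℤ₂`. Genus door, NO Lim fact; UPGRADES
`conjA_two_135b1 hLim2` (GEN 43). BSD for `135b1` is NOT proved by this. [cite: CoatesSujatha2005, Conj. A and Thm. 3.4]
[cite: Greenberg2001IwasawaPastPresent, Prop. 2.1 p. 339] [cite: Cohen1993, Prop. 4.8.11] -/
theorem conjA_two_135b1' (κ : ZpExtension ℚ 2) (hκ : κ.IsCyclotomic) :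
    haveI := isElliptic_135b1
    ∃ (γ : absoluteGaloisGroup ℚ) (D : ((⟨0, 0, 1, -27, -115⟩ : WeierstrassCurve ℤ).baseChange ℚ).FineSelmerDualData κ γ),
      Module.Finite ℤ_[2] (RestrictScalars ℤ_[2] (IwasawaAlgebra 2) D.X) := by
  haveI := isElliptic_135b1
  refine conjA_two_goodSSModel_of_generator_of_discr_neg (0) (-27) (-115) (0) (0) (-2) (-16/15) (-1/90) (1/270) (0) (6) (12)
    (fun β θ hβ hθ ↦ ?_) (by norm_num [Cubic.discr]) (fun θ hθ ↦ not_two_dvd_card_classGroup_twoDivField_d108n hθ) κ hκ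
  subst hθ; push_cast at hβ ⊢
  exact ⟨by linear_combination (((319 : AlgebraicClosure ℚ) / 729000) + ((-1 : AlgebraicClosure ℚ) / 48600) * β + ((-1 : AlgebraicClosure ℚ) / 2187000) * β ^ 2 + ((1 : AlgebraicClosure ℚ) / 19683000) * β ^ 3) * hβ,
    by linear_combination (-1 : AlgebraicClosure ℚ) * (((-2 : AlgebraicClosure ℚ) / 2025) + ((1 : AlgebraicClosure ℚ) / 6075) * β) * hβ⟩

/-- **`FineMuZeroAt (135b1 ⊗ ℚ) 2` UNCONDITIONALLY** (stub-3 currency; upgrades `fineMuZeroAt_two_135b1 hLim2`).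
[cite: CoatesSujatha2005, Conj. A and Thm. 3.4] -/
theorem fineMuZeroAt_two_135b1' :
    haveI := isElliptic_135b1
    Literature.NumberTheory.EllipticCurves.Rank1Residual.FineMuZeroAt ((⟨0, 0, 1, -27, -115⟩ : WeierstrassCurve ℤ).baseChange ℚ) 2 :=
  haveI := isElliptic_135b1
  Literature.NumberTheory.EllipticCurves.Rank1Residual.ConjAAt.fineMuZeroAt conjA_two_135b1'

end Summit.BirchSwinnertonDyer.BirchSwinnertonDyer.Theorems.AddKatoTwo

end
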